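import Mathlib
import Summits.PneNP.PneNP.Theses.PhaseTwins
import Literature.Computability.Complexity.HardcoreInapproximability
import Literature.Computability.Complexity.ApproximateCounting
import Literature.Computability.Complexity.ProbabilisticClasses
import Literature.Computability.Complexity.CircuitClassesUniformProofs
import Literature.Computability.Cryptography.CryptoFoundationsOneWayFunctionsProofs
import Summits.PneNP.PneNP.Theorems.NPNotSubsetPPoly

/-!
# Sketch (ideator 3, round 1) for crux `PhaseTwins.NoFBPPApproxAboveUniqueness` (stmt-PneNP-2717)

First-lemma signatures of idea card `zero-temperature-window-bridge`. Nothing is proved here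
(`sorry` everywhere); the point is that every statement ELABORATES over existing declarations.

* `mem_BPP_of_fbppApprox_window` — the ONE new stub of the line (FBPP plumbing): an FBPP
  approximator for `hardcoreCount Δ p q` plus an `FP` map sending a language `L` into a factor-8
  counting window with an `FP`-computable threshold puts `L` in `BPP`.
* `hardcoreCount_window_lower/upper` — the zero-temperature window (abstract form of the sibling
  crux 2721's stub S4b): at `(p, q) = (2^K, 1)` the count is `2^{K·α}` up to a factor `2^n`.
* `independencePolynomial_blowup` / `maxDegree_blowup_le` — activity renormalisation by vertex
  blow-up, `Z_{G[t]}(λ) = Z_G((1+λ)^t - 1)`: transports the window to every positive activity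
  (in particular to `λ = 1`, #IS).
* `hardCoreThreshold_lt_of_le` — threshold bookkeeping (`λ_c(Δ) ≤ λ_c(3) = 4 < 2^K`).
* the two SHAPE statements of the line and of its converse:
  `noFBPPApprox_of_not_NP_subset_BPP : ¬ NP ⊆ BPP → X` (the line) and
  `not_NP_subset_BPP_of_noFBPPApprox : HardcoreCountSharpP → X → ¬ NP ⊆ BPP` (Stockmeyer with a
  `BPP` oracle eliminated; shows the hypothesis is OPTIMAL: X ⟺ ¬ NP ⊆ BPP),
  plus the two REGISTERED-conjecture entries `…_of_OWFExist`, `…_of_NPNotSubsetPPoly`.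
-/

namespace Summit.PneNP.PneNP.Cruxes.NoFBPPApproxAboveUniqueness.SketchIdeator3

open Literature.Computability.Complexity Literature.Probability.LatticeModels
open _root_.Computability
open Summit.PneNP.PneNP.Theses.PhaseTwins (NoFBPPApproxAboveUniqueness HardcoreCountSharpP)

/-! ## Sanity: the route's inlined count and threshold are the library's (definitional). -/

open scoped Classical in
example (Δ p q : ℕ) (x : List Bool) : hardcoreCount Δ p q x =
    (match encodingGraph.decode x with
      | none => 0
      | some G => if G.2.maxDegree ≤ Δ then ∑ I : Finset (Fin G.1),
          (if G.2.IsIndepSet (↑I : Set (Fin G.1)) then p ^ I.card * q ^ (G.1 - I.card) else 0) else 0) :=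
  rfl

example (Δ : ℕ) : hardCoreThreshold Δ = ((Δ : ℝ) - 1) ^ (Δ - 1) / ((Δ : ℝ) - 2) ^ Δ := rfl

/-! ## Lemma 1 — the new stub: FBPP plumbing (approximator + window reduction ⇒ BPP decision) -/

/-- An FBPP approximator `F` (format of `ApproximateCounting.lean`: coins read from the query,
failure `≤ 1/kδ` under `uniformProb`) for `N = hardcoreCount Δ p q`, together with `T, θ ∈ FP` such
that `T` maps `w ∈ L` to codes with `N ≥ 8·θ(w)` and `w ∉ L` to codes with `0 < N ≤ θ(w)`, puts `L`
in `BPP`: on coins `y` of polynomial length run `F` on `countQuery (T w) (r |T w|) 1 3 (y.take c(…))`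
(factor-2 accuracy, confidence 2/3) and accept iff the estimate exceeds `3·θ(w)`; the coin prefix is
handled by `uniformProb_take_of_le`, the output-length bound of `T` by the `FP` toolkit
(cf. `BPClosureProofs`). -/
theorem mem_BPP_of_fbppApprox_window {Δ p q : ℕ} {F : List Bool → List Bool} (hF : F ∈ FP)
    (c r : Polynomial ℕ)
    (happrox : ∀ (x : List Bool) (kη kδ : ℕ), 0 < kη → 0 < kδ →
      uniformProb (c.eval (x.length + r.eval x.length + kη + kδ))
        {u | ¬ IsApproxCount kη (hardcoreCount Δ p q x)
          (countEstimate F x (r.eval x.length) kη kδ u)} ≤ 1 / (kδ : ℝ))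
    {L : Language Bool} {T θ : List Bool → List Bool} (hT : T ∈ FP) (hθ : θ ∈ FP)
    (hyes : ∀ w ∈ L, 8 * decodeNat (θ w) ≤ hardcoreCount Δ p q (T w))
    (hno : ∀ w ∉ L, 0 < hardcoreCount Δ p q (T w) ∧ hardcoreCount Δ p q (T w) ≤ decodeNat (θ w)) :
    L ∈ BPP := by
  sorry

/-! ## Lemma 2 — the zero-temperature window (abstract form of 2721's S4b) -/

open scoped Classical in
/-- Lower half of the window: an independent set of size `a` contributes `(2^K)^a`. -/
theorem hardcoreCount_window_lower (Δ K : ℕ) {n : ℕ} (G : SimpleGraph (Fin n))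
    (hG : G.maxDegree ≤ Δ) (I : Finset (Fin n)) (hI : G.IsIndepSet (↑I : Set (Fin n))) :
    2 ^ (K * I.card) ≤ hardcoreCount Δ (2 ^ K) 1 (encodingGraph.encode ⟨n, G⟩) := by
  sorry

open scoped Classical in
/-- Upper half of the window: at most `2^n` independent sets, each of weight `≤ (2^K)^b` when the
independence number is `≤ b`. -/
theorem hardcoreCount_window_upper (Δ K b : ℕ) {n : ℕ} (G : SimpleGraph (Fin n))
    (hG : G.maxDegree ≤ Δ) (hb : ∀ I : Finset (Fin n), G.IsIndepSet (↑I : Set (Fin n)) → I.card ≤ b) :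
    hardcoreCount Δ (2 ^ K) 1 (encodingGraph.encode ⟨n, G⟩) ≤ 2 ^ n * 2 ^ (K * b) := by
  sorry

/-- Window arithmetic: with `K·γnum·m ≥ (3m + 3)·γden` the YES floor `2^{Km}` is `≥ 8×` the NO
ceiling `2^{3m} · 2^{K·b}` whenever `γden · b ≤ (γden - γnum) · m` (i.e. `b ≤ (1-γ) m`). Pure `ℕ`
arithmetic, recorded to make the constants checkable. -/
theorem window_separates {K m b γnum γden : ℕ} (hγ : γnum ≤ γden)
    (hK : (3 * m + 3) * γden ≤ K * γnum * m) (hb : γden * b ≤ (γden - γnum) * m) :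
    8 * (2 ^ (3 * m) * 2 ^ (K * b)) ≤ 2 ^ (K * m) := by
  sorry

/-! ## Lemma 3 — activity renormalisation by vertex blow-up -/

open scoped Classical in
/-- `Z_{G[t]}(λ) = Z_G((1+λ)^t − 1)`, where `G[t] = G.comap Prod.fst` on `V × Fin t` replaces every
vertex by `t` pairwise non-adjacent copies and every edge by a complete bipartite graph: an
independent set of `G[t]` is an independent set `I` of `G` together with a NONEMPTY set of copies
for each `v ∈ I`, and `Σ_{∅ ≠ S ⊆ Fin t} λ^{|S|} = (1+λ)^t − 1`. -/
theorem independencePolynomial_blowup {V : Type*} [Fintype V] [DecidableEq V]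
    (G : SimpleGraph V) (t : ℕ) (lam : ℝ) :
    independencePolynomial (G.comap (Prod.fst : V × Fin t → V)) lam
      = independencePolynomial G ((1 + lam) ^ t - 1) := by
  sorry

open scoped Classical in
/-- The blow-up multiplies degrees by `t`. -/
theorem maxDegree_blowup_le {V : Type*} [Fintype V] [DecidableEq V] (G : SimpleGraph V) (t : ℕ) :
    (G.comap (Prod.fst : V × Fin t → V)).maxDegree ≤ t * G.maxDegree := by
  sorry

/-! ## Lemma 4 — threshold bookkeeping -/

/-- `λ_c` is largest at `Δ = 3` (`= 4`); so any activity `≥ 8` (e.g. `2^K`, `K ≥ 3`) is above the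
uniqueness threshold at every `Δ ≥ 3`. -/
theorem hardCoreThreshold_le_four {Δ : ℕ} (hΔ : 3 ≤ Δ) : hardCoreThreshold Δ ≤ 4 := by
  sorry

theorem hardCoreThreshold_lt_two_pow {Δ K : ℕ} (hΔ : 3 ≤ Δ) (hK : 3 ≤ K) :
    hardCoreThreshold Δ < ((2 ^ K : ℕ) : ℝ) / ((1 : ℕ) : ℝ) := by
  sorry

/-! ## Shape of the line and of its converse (both conclude / consume the crux BY NAME) -/

/-- THE LINE: `¬ NP ⊆ BPP → X` (hypothesis inline; to be registered as `NPNotSubsetBPP`). -/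
theorem noFBPPApprox_of_not_NP_subset_BPP (h : ¬ (Nondeterministic.NP ⊆ BPP)) :
    NoFBPPApproxAboveUniqueness := by
  sorry

/-- Entry through the REGISTERED conjecture `OWFExist` (bridge PROVED in the tree). -/
theorem noFBPPApprox_of_OWFExist (h : Literature.Computability.Cryptography.OWFExist) : NoFBPPApproxAboveUniqueness :=
  noFBPPApprox_of_not_NP_subset_BPP
    (Literature.Computability.Cryptography.NP_not_subset_BPP_of_OWFExist_holds h)

/-- Entry through the REGISTERED conjecture `NPNotSubsetPPoly` (Adleman, PROVED: `BPP ⊆ P/poly`). -/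
theorem noFBPPApprox_of_NPNotSubsetPPoly (h : Summit.PneNP.PneNP.NPNotSubsetPPoly) :
    NoFBPPApproxAboveUniqueness :=
  noFBPPApprox_of_not_NP_subset_BPP fun hNP => h (hNP.trans BPP_subset_PPoly_holds)

/-- THE CONVERSE (optimality of the hypothesis): Stockmeyer (`stockmeyerApproxCounting_holds`, PROVED)
at `O = ∅` for the `#P` witnesses of `hardcoreCount` (support item `HardcoreCountSharpP`), with the
`NP` oracle eliminated under `NP ⊆ BPP` (adaptive `BPP` simulation with error reduction, cf.
`AdaptiveBPPSimulation.lean`), yields an FBPP approximator at EVERY `(Δ, p, q)`. -/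
theorem not_NP_subset_BPP_of_noFBPPApprox (hN : HardcoreCountSharpP) (hX : NoFBPPApproxAboveUniqueness) :
    ¬ (Nondeterministic.NP ⊆ BPP) := by
  sorry

end Summit.PneNP.PneNP.Cruxes.NoFBPPApproxAboveUniqueness.SketchIdeator3
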